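import Mathlib.Analysis.SpecialFunctions.Complex.Circle
import Mathlib.Analysis.Convex.Contractible
import Mathlib.Analysis.LocallyConvex.WithSeminorms
import Mathlib.Topology.Homotopy.Lifting
import Mathlib.Topology.Connected.LocallyPathConnected
import Mathlib.AlgebraicTopology.FundamentalGroupoid.FundamentalGroup
import Mathlib.AlgebraicTopology.FundamentalGroupoid.SimplyConnected
import HarnessLib

/-!
# Loops in spun spaces: the fibre coordinate can be unwound

Topic `Literature/AlgebraicTopology/FundamentalGroup` (general topology, used for the fact seat
`provefact-Literature.Topology.FourManifolds.exists_diffeomorph_comp_incl_eq`, brick SYMMᴹ: the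
`π₁`-triviality of the mirror symmetry of the `1`-handlebody models
`{q(x, y) + z² + w² ≤ c} ⊂ ℝ⁴`, whose boundary `{q(x, y) + z² + w² = c}` is a *spun space* over
the planar domain `{q ≤ c}`).  Everything here is **proved**.

**Spun spaces.**  For a topological space `B` and a continuous `r : B → ℝ`, `r ≥ 0`, the
*spun space* of `(B, r)` is the subspace
`Spun r = {(b, v) ∈ B × ℂ | ‖v‖ = r b}` of `B × ℂ`: over the open set `{r > 0}` a circle
bundle, over `{r = 0}` a copy of `{r = 0}`.  (The boundary `#ᵏ(S¹ × S²)` of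
`♮ᵏ(S¹ × B³) = {q(x, y) + z² + w² ≤ c}` is `Spun √(c - q)` over the disc with `k` holes
`{q ≤ c} ⊂ ℝ²` — "spinning" the planar domain about its boundary.)  It carries the
**section** `sec b = (b, r b)` and the **conjugation** `conjMap (b, v) = (b, v̄)`.

**Theorem** (`Literature.AlgebraicTopology.FundamentalGroup.Spun.homotopic_secPath`).  Let
`x₀ = (b₀, 0) ∈ Spun r` be a point with vanishing fibre coordinate (so `r b₀ = 0`).  Then every
loop `γ` of `Spun r` at `x₀` is homotopic (rel endpoints) to the loop `sec ∘ pr₁ ∘ γ` in the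
section.

*Proof* (explicit).  Write `γ = (β, v)` with `‖v(s)‖ = r(β(s))`.  On the open set
`O = {s | v(s) ≠ 0} ⊆ (0, 1)` the unit vector `v/‖v‖` is a continuous map to the circle; on
each component `(a, b)` of `O` — `a(t) = sup {s ≤ t | v(s) = 0}`, `b(t) = inf {s ≥ t | v(s) = 0}`
— it lifts through the covering `exp : ℝ → S¹` (Mathlib's
`IsCoveringMap.existsUnique_continuousMap_lifts` on the simply connected interval, normalised at
the midpoint), giving a continuous angle `φ : O → ℝ` with `v = ‖v‖ e^{iφ}`.  The homotopy
`H(τ, s) = (β(s), ‖v(s)‖ e^{i(1-τ)φ(s)})` on `O`, `H(τ, s) = (β(s), 0)` off `O`, stays in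
`Spun r`, is continuous (the modulus `‖v(s)‖ → 0` at the frontier of `O` masks the angle), fixes
the endpoints (`v(0) = v(1) = 0`), and runs from `γ` to `(β, ‖v‖) = (β, r ∘ β) = sec ∘ β`.

**Corollary** (`Spun.homotopic_conjLoop`, `Spun.mapOfEq_conjCM_eq`).  `conjMap ∘ γ` and
`γ` are both homotopic to `sec ∘ pr₁ ∘ γ`, so the conjugation acts as the identity on
`π₁(Spun r, x₀)` for every base point with vanishing fibre coordinate.  (Classically: the free
group `π₁(#ᵏ S¹ × S²)` is generated by loops in the mirror of the reflection; Laudenbach–Poénaru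
(1972), §2, p. 342, use an orientation-reversing diffeomorphism "with `(F₁)_# =` the
identity".)

## References

* A. Hatcher, *Algebraic Topology* (2002), §1.1 (induced homomorphisms), Prop. 1.30 / 1.33
  (lifting). [HatcherAT2002]
* F. Laudenbach, V. Poénaru, *A note on 4-dimensional handlebodies*, Bull. Soc. Math. France
  100 (1972), §2, p. 342. [LaudenbachPoenaruBSMF1972]
-/

open Set Function Filter Topology Complex
open scoped unitInterval ComplexConjugate

noncomputable section

namespace Literature.AlgebraicTopology.FundamentalGroup

namespace Spun

/-! ### Unit vectors and angle lifts on intervals -/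

section AngleLift

/-- The unit vector `v / ‖v‖` of a nonzero complex number, as a point of the circle.
[folklore] -/
def unitOf (v : ℂ) (hv : v ≠ 0) : Circle :=
  ⟨((‖v‖ : ℂ))⁻¹ * v, show ((‖v‖ : ℂ))⁻¹ * v ∈ Metric.sphere (0 : ℂ) 1 by
    rw [mem_sphere_zero_iff_norm, norm_mul, norm_inv, Complex.norm_real, Real.norm_eq_abs,
      abs_of_nonneg (norm_nonneg v), inv_mul_cancel₀ (norm_ne_zero_iff.2 hv)]⟩

/-- `‖v‖ · (v / ‖v‖) = v`. [folklore] -/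
theorem norm_mul_unitOf (v : ℂ) (hv : v ≠ 0) : (‖v‖ : ℂ) * (unitOf v hv : ℂ) = v := by
  show (‖v‖ : ℂ) * (((‖v‖ : ℂ))⁻¹ * v) = v
  rw [← mul_assoc, mul_inv_cancel₀ (by exact_mod_cast norm_ne_zero_iff.2 hv), one_mul]

variable {g : ℝ → ℂ} (hg : Continuous g)

/-- The unit-vector map `t ↦ g t / ‖g t‖` on an interval on which `g ≠ 0`, as a continuous map
to the circle. [folklore] -/
def unitMap (α β : ℝ) (hsub : ∀ t ∈ Ioo α β, g t ≠ 0) : C(Ioo α β, Circle) where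
  toFun t := unitOf (g t) (hsub t t.2)
  continuous_toFun := by
    refine Continuous.subtype_mk ?_ _
    refine Continuous.mul ?_ (hg.comp continuous_subtype_val)
    refine Continuous.inv₀ (continuous_ofReal.comp (continuous_norm.comp
      (hg.comp continuous_subtype_val))) fun t => ?_
    exact_mod_cast norm_ne_zero_iff.2 (hsub t t.2)

include hg in
/-- **Angle lift on an interval.**  On an open interval on which `g ≠ 0`, the unit vector
`g / ‖g‖` lifts through the covering map `exp : ℝ → S¹` (Mathlib
`IsCoveringMap.existsUnique_continuousMap_lifts`; the interval is simply connected and locally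
path connected), normalised at the midpoint by the principal argument (Hatcher (2002),
Prop. 1.33). [cite: HatcherAT2002, Prop. 1.33] -/
theorem exists_lift (α β : ℝ) (hαβ : α < β) (hsub : ∀ t ∈ Ioo α β, g t ≠ 0) :
    ∃ F : C(Ioo α β, ℝ), (∀ t, Circle.exp (F t) = unitMap hg α β hsub t) ∧
      F ⟨(α + β) / 2, by constructor <;> linarith⟩ =
        arg (unitMap hg α β hsub ⟨(α + β) / 2, by constructor <;> linarith⟩ : ℂ) := by
  have hne : (Ioo α β).Nonempty := ⟨(α + β) / 2, by constructor <;> linarith⟩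
  haveI : ContractibleSpace (Ioo α β) := (convex_Ioo α β).contractibleSpace hne
  haveI : LocallyPathConnectedSpace (Ioo α β) := isOpen_Ioo.locallyPathConnectedSpace
  obtain ⟨F, ⟨hF0, hF⟩, -⟩ := Circle.isCoveringMap_exp.existsUnique_continuousMap_lifts
    (unitMap hg α β hsub) ⟨(α + β) / 2, by constructor <;> linarith⟩
    (arg (unitMap hg α β hsub ⟨(α + β) / 2, by constructor <;> linarith⟩ : ℂ))
    (Circle.exp_arg _)
  exact ⟨F, fun t => congrFun hF t, hF0⟩

/-- A chosen angle lift on an interval (`exists_lift`). [folklore] -/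
def lift (α β : ℝ) (hαβ : α < β) (hsub : ∀ t ∈ Ioo α β, g t ≠ 0) : C(Ioo α β, ℝ) :=
  (exists_lift hg α β hαβ hsub).choose

/-- The chosen lift is a lift: `exp (lift t) = g t / ‖g t‖`. [folklore] -/
theorem exp_lift (α β : ℝ) (hαβ : α < β) (hsub : ∀ t ∈ Ioo α β, g t ≠ 0) (t : Ioo α β) :
    Circle.exp (lift hg α β hαβ hsub t) = unitOf (g t) (hsub t t.2) :=
  (exists_lift hg α β hαβ hsub).choose_spec.1 t

/-- `‖g t‖ · exp (i · lift t) = g t` on the interval. [folklore] -/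
theorem norm_mul_exp_lift (α β : ℝ) (hαβ : α < β) (hsub : ∀ t ∈ Ioo α β, g t ≠ 0)
    (t : Ioo α β) : (‖g t‖ : ℂ) * (Circle.exp (lift hg α β hαβ hsub t) : ℂ) = g t := by
  rw [exp_lift, norm_mul_unitOf]

/-- Chosen lifts over intervals with equal endpoints agree (they are the same chosen object).
[folklore] -/
theorem lift_congr {α β α' β' : ℝ} (hα : α = α') (hβ : β = β') (hαβ : α < β)
    (hsub : ∀ t ∈ Ioo α β, g t ≠ 0) {t : ℝ} (ht : t ∈ Ioo α β) :
    lift hg α β hαβ hsub ⟨t, ht⟩ =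
      lift hg α' β' (hα ▸ hβ ▸ hαβ) (fun s hs => hsub s (by rw [hα, hβ]; exact hs))
        ⟨t, by rw [← hα, ← hβ]; exact ht⟩ := by
  subst hα hβ
  rfl

end AngleLift

/-! ### The fibre coordinate of a loop: components of `{g ≠ 0}` -/

/-- The properties of the fibre coordinate `g = pr₂ ∘ γ.extend : ℝ → ℂ` of a loop of a spun
space at a point with vanishing fibre coordinate: continuous, and zero outside `(0, 1)`.
[folklore] -/
structure IsLoopFibre (g : ℝ → ℂ) : Prop where
  /-- `g` is continuous. -/
  continuous : Continuous g
  /-- `g` vanishes outside the open unit interval. -/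
  eq_zero_of_not_mem : ∀ t, t ∉ Ioo (0 : ℝ) 1 → g t = 0

section Components

/-- The left end `a(t) = sup {s ≤ t | g s = 0}` of the component of `t` in `{g ≠ 0}`.
[folklore] -/
def leftEnd (g : ℝ → ℂ) (t : ℝ) : ℝ := sSup (Iic t ∩ {s | g s = 0})

/-- The right end `b(t) = inf {s ≥ t | g s = 0}` of the component of `t` in `{g ≠ 0}`.
[folklore] -/
def rightEnd (g : ℝ → ℂ) (t : ℝ) : ℝ := sInf (Ici t ∩ {s | g s = 0})

variable {g : ℝ → ℂ} (H : IsLoopFibre g)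
include H

/-- `g 0 = 0`. [folklore] -/
theorem IsLoopFibre.map_zero : g 0 = 0 := H.eq_zero_of_not_mem 0 fun h => lt_irrefl _ h.1

/-- `g 1 = 0`. [folklore] -/
theorem IsLoopFibre.map_one : g 1 = 0 := H.eq_zero_of_not_mem 1 fun h => lt_irrefl _ h.2

/-- The zero set of `g` is closed. [folklore] -/
theorem IsLoopFibre.isClosed_zeroSet : IsClosed {s : ℝ | g s = 0} :=
  isClosed_eq H.continuous continuous_const

/-- A point where `g ≠ 0` lies in `(0, 1)`. [folklore] -/
theorem IsLoopFibre.mem_Ioo {t : ℝ} (ht : g t ≠ 0) : t ∈ Ioo (0 : ℝ) 1 := by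
  by_contra h
  exact ht (H.eq_zero_of_not_mem t h)

/-- `a(t)` is a zero of `g`, `a(t) ≤ t`. [folklore] -/
theorem IsLoopFibre.leftEnd_mem {t : ℝ} (ht : g t ≠ 0) : leftEnd g t ∈ Iic t ∩ {s | g s = 0} :=
  (isClosed_Iic.inter H.isClosed_zeroSet).csSup_mem ⟨0, (H.mem_Ioo ht).1.le, H.map_zero⟩
    ⟨t, fun _ hs => hs.1⟩

/-- `b(t)` is a zero of `g`, `t ≤ b(t)`. [folklore] -/
theorem IsLoopFibre.rightEnd_mem {t : ℝ} (ht : g t ≠ 0) :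
    rightEnd g t ∈ Ici t ∩ {s | g s = 0} :=
  (isClosed_Ici.inter H.isClosed_zeroSet).csInf_mem ⟨1, (H.mem_Ioo ht).2.le, H.map_one⟩
    ⟨t, fun _ hs => hs.1⟩

omit H in
/-- `g ≠ 0` on `(a(t), t]`. [folklore] -/
theorem ne_zero_of_leftEnd_lt {t s : ℝ} (hs : leftEnd g t < s) (hst : s ≤ t) : g s ≠ 0 :=
  fun hgs => not_le.2 hs (le_csSup ⟨t, fun _ hu => hu.1⟩ ⟨hst, hgs⟩)

omit H in
/-- `g ≠ 0` on `[t, b(t))`. [folklore] -/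
theorem ne_zero_of_lt_rightEnd {t s : ℝ} (hts : t ≤ s) (hs : s < rightEnd g t) : g s ≠ 0 :=
  fun hgs => not_le.2 hs (csInf_le ⟨t, fun _ hu => hu.1⟩ ⟨hts, hgs⟩)

/-- `t` lies in its component interval `(a(t), b(t))`. [folklore] -/
theorem IsLoopFibre.mem_Ioo_ends {t : ℝ} (ht : g t ≠ 0) : t ∈ Ioo (leftEnd g t) (rightEnd g t) :=
  ⟨lt_of_le_of_ne (H.leftEnd_mem ht).1 fun h => ht (h ▸ (H.leftEnd_mem ht).2),
    lt_of_le_of_ne (H.rightEnd_mem ht).1 fun h => ht (h.symm ▸ (H.rightEnd_mem ht).2)⟩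

/-- `a(t) < b(t)`. [folklore] -/
theorem IsLoopFibre.leftEnd_lt_rightEnd {t : ℝ} (ht : g t ≠ 0) : leftEnd g t < rightEnd g t :=
  (H.mem_Ioo_ends ht).1.trans (H.mem_Ioo_ends ht).2

omit H in
/-- `g ≠ 0` on the whole component interval `(a(t), b(t))`. [folklore] -/
theorem ne_zero_of_mem_Ioo_ends {t s : ℝ} (hs : s ∈ Ioo (leftEnd g t) (rightEnd g t)) :
    g s ≠ 0 := by
  rcases le_total s t with hst | hts
  · exact ne_zero_of_leftEnd_lt hs.1 hst
  · exact ne_zero_of_lt_rightEnd hts hs.2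

/-- Points of the same component interval have the same left end. [folklore] -/
theorem IsLoopFibre.leftEnd_eq_of_mem {t s : ℝ} (ht : g t ≠ 0)
    (hs : s ∈ Ioo (leftEnd g t) (rightEnd g t)) : leftEnd g s = leftEnd g t := by
  have hgs : g s ≠ 0 := ne_zero_of_mem_Ioo_ends hs
  apply le_antisymm
  · -- zeros `≤ s` are `≤ a(t)`: otherwise they would lie in `(a(t), b(t))`
    refine csSup_le ⟨0, (H.mem_Ioo hgs).1.le, H.map_zero⟩ fun u hu => ?_
    by_contra hlt
    rw [not_le] at hlt
    exact ne_zero_of_mem_Ioo_ends ⟨hlt, lt_of_le_of_lt hu.1 hs.2⟩ hu.2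
  · exact le_csSup ⟨s, fun _ hu => hu.1⟩ ⟨hs.1.le, (H.leftEnd_mem ht).2⟩

/-- Points of the same component interval have the same right end. [folklore] -/
theorem IsLoopFibre.rightEnd_eq_of_mem {t s : ℝ} (ht : g t ≠ 0)
    (hs : s ∈ Ioo (leftEnd g t) (rightEnd g t)) : rightEnd g s = rightEnd g t := by
  have hgs : g s ≠ 0 := ne_zero_of_mem_Ioo_ends hs
  apply le_antisymm
  · exact csInf_le ⟨s, fun _ hu => hu.1⟩ ⟨hs.2.le, (H.rightEnd_mem ht).2⟩
  · refine le_csInf ⟨1, (H.mem_Ioo hgs).2.le, H.map_one⟩ fun u hu => ?_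
    by_contra hlt
    rw [not_le] at hlt
    exact ne_zero_of_mem_Ioo_ends ⟨lt_of_lt_of_le hs.1 hu.1, hlt⟩ hu.2

end Components

/-! ### The global angle and the unwinding of the fibre coordinate -/

section Unwind

variable {g : ℝ → ℂ} (H : IsLoopFibre g)

/-- **The global angle** `φ : {g ≠ 0} → ℝ`: at `t`, the chosen lift on the component interval
`(a(t), b(t))` of `t`, evaluated at `t`; junk value `0` where `g = 0`. [folklore] -/
def angle (t : ℝ) : ℝ :=
  if ht : g t ≠ 0 then
    lift H.continuous (leftEnd g t) (rightEnd g t) (H.leftEnd_lt_rightEnd ht)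
      (fun _ hs => ne_zero_of_mem_Ioo_ends hs) ⟨t, H.mem_Ioo_ends ht⟩
  else 0

/-- On the component interval of `t`, the global angle is the chosen lift of that interval.
[folklore] -/
theorem angle_eq_lift {t : ℝ} (ht : g t ≠ 0) {s : ℝ}
    (hs : s ∈ Ioo (leftEnd g t) (rightEnd g t)) :
    angle H s = lift H.continuous (leftEnd g t) (rightEnd g t) (H.leftEnd_lt_rightEnd ht)
      (fun _ hu => ne_zero_of_mem_Ioo_ends hu) ⟨s, hs⟩ := by
  have hgs : g s ≠ 0 := ne_zero_of_mem_Ioo_ends hs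
  rw [angle, dif_pos hgs]
  exact lift_congr H.continuous (H.leftEnd_eq_of_mem ht hs) (H.rightEnd_eq_of_mem ht hs) _ _ _

/-- **The global angle is continuous where `g ≠ 0`.** [folklore] -/
theorem continuousAt_angle {t : ℝ} (ht : g t ≠ 0) : ContinuousAt (angle H) t := by
  have hmem := H.mem_Ioo_ends ht
  set L := lift H.continuous (leftEnd g t) (rightEnd g t) (H.leftEnd_lt_rightEnd ht)
    (fun _ hu => ne_zero_of_mem_Ioo_ends hu) with hL
  have hcont : ContinuousOn (angle H) (Ioo (leftEnd g t) (rightEnd g t)) := by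
    rw [continuousOn_iff_continuous_restrict]
    refine L.continuous.congr fun s => ?_
    exact (angle_eq_lift H ht s.2).symm
  exact hcont.continuousAt (isOpen_Ioo.mem_nhds hmem)

/-- **The global angle is an angle**: `‖g t‖ e^{i φ(t)} = g t` wherever `g t ≠ 0`. [folklore] -/
theorem norm_mul_exp_angle {t : ℝ} (ht : g t ≠ 0) :
    (‖g t‖ : ℂ) * (Circle.exp (angle H t) : ℂ) = g t := by
  rw [angle_eq_lift H ht (H.mem_Ioo_ends ht)]
  exact norm_mul_exp_lift H.continuous _ _ _ _ ⟨t, _⟩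

/-- **The unwinding of the fibre coordinate**: `U(τ, t) = ‖g t‖ e^{i (1 - τ) φ(t)}`
(`= 0` where `g t = 0`, whatever the junk angle). [folklore] -/
def unwind (p : ℝ × ℝ) : ℂ :=
  (‖g p.2‖ : ℂ) * (Circle.exp ((1 - p.1) * angle H p.2) : ℂ)

/-- `‖U(τ, t)‖ = ‖g t‖`. [folklore] -/
theorem norm_unwind (p : ℝ × ℝ) : ‖unwind H p‖ = ‖g p.2‖ := by
  rw [unwind, norm_mul, Circle.norm_coe, mul_one, Complex.norm_real, Real.norm_eq_abs,
    abs_of_nonneg (norm_nonneg _)]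

/-- `U(0, t) = g t`. [folklore] -/
theorem unwind_zero (t : ℝ) : unwind H (0, t) = g t := by
  by_cases ht : g t ≠ 0
  · rw [unwind, sub_zero, one_mul]
    exact norm_mul_exp_angle H ht
  · rw [not_not] at ht
    rw [unwind]
    show ((‖g t‖ : ℝ) : ℂ) * _ = g t
    rw [ht, norm_zero, ofReal_zero, zero_mul]

/-- `U(1, t) = ‖g t‖`. [folklore] -/
theorem unwind_one (t : ℝ) : unwind H (1, t) = ‖g t‖ := by
  rw [unwind, sub_self, zero_mul, Circle.exp_zero, Circle.coe_one, mul_one]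

/-- `U(τ, t) = 0` where `g t = 0`. [folklore] -/
theorem unwind_eq_zero {τ t : ℝ} (ht : g t = 0) : unwind H (τ, t) = 0 := by
  rw [unwind]
  show ((‖g t‖ : ℝ) : ℂ) * _ = 0
  rw [ht, norm_zero, ofReal_zero, zero_mul]

/-- **The unwinding is continuous**: near points with `g ≠ 0` it is a product of continuous
functions; at points with `g = 0` its modulus `‖g‖` tends to `0`. [folklore] -/
theorem continuous_unwind : Continuous (unwind H) := by
  have hg := H.continuous
  rw [continuous_iff_continuousAt]
  rintro ⟨τ, t⟩
  by_cases ht : g t ≠ 0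
  · -- product of continuous functions near `(τ, t)`
    have h1' : ContinuousAt (fun p : ℝ × ℝ => ((‖g p.2‖ : ℝ) : ℂ)) (τ, t) :=
      (continuous_ofReal.comp (continuous_norm.comp (hg.comp continuous_snd))).continuousAt
    have hang : ContinuousAt (fun p : ℝ × ℝ => angle H p.2) (τ, t) := by
      have hc : ContinuousAt (angle H ∘ Prod.snd) (τ, t) :=
        ContinuousAt.comp (f := Prod.snd) (g := angle H) (x := (τ, t))
          (continuousAt_angle H ht) continuous_snd.continuousAt
      exact hc
    have h2' : ContinuousAt (fun p : ℝ × ℝ => (1 - p.1) * angle H p.2) (τ, t) :=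
      ((continuous_const.sub continuous_fst).continuousAt).mul hang
    have h3' : ContinuousAt (fun p : ℝ × ℝ =>
        (Circle.exp ((1 - p.1) * angle H p.2) : ℂ)) (τ, t) :=
      (continuous_subtype_val.comp Circle.exp.continuous).continuousAt.comp h2'
    exact h1'.mul h3'
  · rw [not_not] at ht
    rw [ContinuousAt, unwind_eq_zero H ht]
    refine tendsto_zero_iff_norm_tendsto_zero.2 ?_
    have hlim : Tendsto (fun p : ℝ × ℝ => ‖g p.2‖) (𝓝 (τ, t)) (𝓝 0) := by
      have := (continuous_norm.comp (hg.comp continuous_snd)).continuousAt (x := (τ, t))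
      rwa [ContinuousAt, comp_apply, comp_apply, ht, norm_zero] at this
    refine squeeze_zero (fun p => norm_nonneg _) (fun p => ?_) hlim
    rw [norm_unwind]

end Unwind

/-! ### Spun spaces, their section and their conjugation -/

end Spun

variable {B : Type*} [TopologicalSpace B]

/-- **The spun space** of `(B, r)`: the subspace `{(b, v) | ‖v‖ = r b}` of `B × ℂ` (a circle
bundle over `{r > 0}`, collapsed to `B` over `{r = 0}`). [folklore] -/
def Spun (r : B → ℝ) : Set (B × ℂ) := {p | ‖p.2‖ = r p.1}

namespace Spun

variable {r : B → ℝ}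

omit [TopologicalSpace B] in
/-- Membership in the spun space. [folklore] -/
theorem mem_iff {p : B × ℂ} : p ∈ Spun r ↔ ‖p.2‖ = r p.1 := Iff.rfl

/-- The base coordinate `pr₁`. [folklore] -/
def proj (p : Spun r) : B := p.1.1

/-- The fibre coordinate `pr₂`. [folklore] -/
def fib (p : Spun r) : ℂ := p.1.2

omit [TopologicalSpace B] in
/-- On the spun space `‖v‖ = r b`. [folklore] -/
theorem norm_fib (p : Spun r) : ‖fib p‖ = r (proj p) := p.2

/-- `pr₁` is continuous. [folklore] -/
theorem continuous_proj : Continuous (proj (r := r)) :=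
  continuous_fst.comp continuous_subtype_val

/-- `pr₂` is continuous. [folklore] -/
theorem continuous_fib : Continuous (fib (r := r)) :=
  continuous_snd.comp continuous_subtype_val

omit [TopologicalSpace B] in
/-- Points of the spun space are determined by their two coordinates. [folklore] -/
theorem ext {p q : Spun r} (h₁ : proj p = proj q) (h₂ : fib p = fib q) : p = q :=
  Subtype.ext (Prod.ext h₁ h₂)

/-- The point of the spun space with coordinates `(b, v)`, `‖v‖ = r b`. [folklore] -/
def mk (b : B) (v : ℂ) (h : ‖v‖ = r b) : Spun r := ⟨(b, v), h⟩

omit [TopologicalSpace B] in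
/-- `pr₁ (b, v) = b`. [folklore] -/
@[simp] theorem proj_mk (b : B) (v : ℂ) (h : ‖v‖ = r b) : proj (mk b v h) = b := rfl

omit [TopologicalSpace B] in
/-- `pr₂ (b, v) = v`. [folklore] -/
@[simp] theorem fib_mk (b : B) (v : ℂ) (h : ‖v‖ = r b) : fib (mk b v h) = v := rfl

/-- **The section** `b ↦ (b, r b)` of the spun space (for `r ≥ 0`). [folklore] -/
def sec (hr0 : ∀ b, 0 ≤ r b) (b : B) : Spun r := mk b (r b) (Complex.norm_of_nonneg (hr0 b))

omit [TopologicalSpace B] in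
/-- `pr₁ ∘ sec = id`. [folklore] -/
@[simp] theorem proj_sec (hr0 : ∀ b, 0 ≤ r b) (b : B) : proj (sec hr0 b) = b := rfl

omit [TopologicalSpace B] in
/-- `pr₂ (sec b) = r b`. [folklore] -/
@[simp] theorem fib_sec (hr0 : ∀ b, 0 ≤ r b) (b : B) : fib (sec hr0 b) = r b := rfl

/-- The section is continuous for continuous `r`. [folklore] -/
theorem continuous_sec (hr : Continuous r) (hr0 : ∀ b, 0 ≤ r b) : Continuous (sec hr0) :=
  Continuous.subtype_mk (continuous_id.prodMk (continuous_ofReal.comp hr)) _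

omit [TopologicalSpace B] in
/-- A point with vanishing fibre coordinate lies in the section. [folklore] -/
theorem sec_proj_eq_of_fib_eq_zero (hr0 : ∀ b, 0 ≤ r b) {x : Spun r} (hx : fib x = 0) :
    sec hr0 (proj x) = x := by
  refine ext rfl ?_
  rw [fib_sec, hx]
  have h := norm_fib x
  rw [hx, norm_zero] at h
  rw [← h, ofReal_zero]

/-- **The conjugation** `(b, v) ↦ (b, v̄)` of the spun space. [folklore] -/
def conjMap (p : Spun r) : Spun r := mk (proj p) (conj (fib p)) (by rw [norm_conj]; exact norm_fib p)

omit [TopologicalSpace B] in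
/-- `pr₁ ∘ conj = pr₁`. [folklore] -/
@[simp] theorem proj_conjMap (p : Spun r) : proj (conjMap p) = proj p := rfl

omit [TopologicalSpace B] in
/-- `pr₂ (conj p) = conj (pr₂ p)`. [folklore] -/
@[simp] theorem fib_conjMap (p : Spun r) : fib (conjMap p) = conj (fib p) := rfl

/-- The conjugation is continuous. [folklore] -/
theorem continuous_conjMap : Continuous (conjMap (r := r)) :=
  Continuous.subtype_mk (continuous_proj.prodMk (continuous_conj.comp continuous_fib)) _

omit [TopologicalSpace B] in
/-- The conjugation fixes the points with real fibre coordinate, in particular those with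
vanishing fibre coordinate. [folklore] -/
theorem conjMap_eq_self_of_fib_eq_zero {x : Spun r} (hx : fib x = 0) : conjMap x = x :=
  ext rfl (by rw [fib_conjMap, hx, map_zero])

/-- The conjugation as a continuous self-map. [folklore] -/
def conjCM : C(Spun r, Spun r) := ⟨conjMap, continuous_conjMap⟩

/-- `conjCM` is `conjMap` as a function. [folklore] -/
@[simp] theorem conjCM_apply (p : Spun r) : conjCM p = conjMap p := rfl

/-! ### Loops at a point with vanishing fibre coordinate -/

section Loops

variable (hr : Continuous r) (hr0 : ∀ b, 0 ≤ r b) {x₀ : Spun r} (hx₀ : fib x₀ = 0)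

/-- **The loop `sec ∘ pr₁ ∘ γ` in the section** accompanying a loop `γ` at a point `x₀` with
vanishing fibre coordinate. [folklore] -/
def secPath (γ : Path x₀ x₀) : Path x₀ x₀ where
  toFun s := sec hr0 (proj (γ s))
  continuous_toFun := (continuous_sec hr hr0).comp (continuous_proj.comp γ.continuous)
  source' := by rw [γ.source]; exact sec_proj_eq_of_fib_eq_zero hr0 hx₀
  target' := by rw [γ.target]; exact sec_proj_eq_of_fib_eq_zero hr0 hx₀

/-- `secPath γ s = sec (pr₁ (γ s))` (definitional). [folklore] -/
@[simp] theorem secPath_apply (γ : Path x₀ x₀) (s : I) :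
    secPath hr hr0 hx₀ γ s = sec hr0 (proj (γ s)) := rfl

/-- **The conjugate loop** `conj ∘ γ`, as a loop at the same base point (the conjugation fixes
points with vanishing fibre coordinate). [folklore] -/
def conjLoop (γ : Path x₀ x₀) : Path x₀ x₀ :=
  (γ.map continuous_conjMap).cast (conjMap_eq_self_of_fib_eq_zero hx₀).symm
    (conjMap_eq_self_of_fib_eq_zero hx₀).symm

/-- `conjLoop γ s = conj (γ s)` (definitional). [folklore] -/
@[simp] theorem conjLoop_apply (γ : Path x₀ x₀) (s : I) : conjLoop hx₀ γ s = conjMap (γ s) := rfl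

/-- The loops `γ` and `conj ∘ γ` have the same accompanying loop in the section. [folklore] -/
theorem secPath_conjLoop (γ : Path x₀ x₀) :
    secPath hr hr0 hx₀ (conjLoop hx₀ γ) = secPath hr hr0 hx₀ γ :=
  Path.ext (funext fun _ => rfl)

variable (γ : Path x₀ x₀)

/-- The fibre coordinate of the extended loop, `g = pr₂ ∘ γ.extend : ℝ → ℂ`. [folklore] -/
def fibExt (γ : Path x₀ x₀) : ℝ → ℂ := fun t => fib (γ.extend t)

include hx₀ in
/-- `g = pr₂ ∘ γ.extend` is continuous and vanishes outside `(0, 1)`. [folklore] -/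
theorem isLoopFibre_fibExt : IsLoopFibre (fibExt γ) := by
  refine ⟨continuous_fib.comp γ.extend.continuous, fun t ht => ?_⟩
  show fib (γ.extend t) = 0
  rcases le_or_gt t 0 with h | h
  · rw [γ.extend_of_le_zero h]; exact hx₀
  · have h1 : 1 ≤ t := by
      by_contra h1
      exact ht ⟨h, not_le.1 h1⟩
    rw [γ.extend_of_one_le h1]; exact hx₀

/-- The unwinding of the fibre coordinate of `γ` (`unwind` for `g = pr₂ ∘ γ.extend`), on
`I × I`. [folklore] -/
def unwindγ (p : I × I) : ℂ :=
  unwind (isLoopFibre_fibExt hx₀ γ) ((p.1 : ℝ), (p.2 : ℝ))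

/-- `fibExt γ s = pr₂ (γ s)` on `[0, 1]`. [folklore] -/
theorem fibExt_coe (s : I) : fibExt γ s = fib (γ s) := by
  show fib (γ.extend (s : ℝ)) = fib (γ s)
  rw [γ.extend_extends' s]

/-- `‖unwindγ (τ, s)‖ = r (pr₁ (γ s))`: the unwound fibre coordinate stays on the spun space.
[folklore] -/
theorem norm_unwindγ (p : I × I) : ‖unwindγ hx₀ γ p‖ = r (proj (γ p.2)) := by
  rw [unwindγ, norm_unwind]
  show ‖fibExt γ (p.2 : ℝ)‖ = r (proj (γ p.2))
  rw [fibExt_coe γ p.2]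
  exact norm_fib _

/-- **The unwinding homotopy** `H(τ, s) = (pr₁ (γ s), ‖v(s)‖ e^{i(1-τ)φ(s)})` from `γ` to
`sec ∘ pr₁ ∘ γ`, rel endpoints. [folklore] -/
def unwindHomotopy : (γ : Path x₀ x₀).Homotopy (secPath hr hr0 hx₀ γ) where
  toFun p := mk (proj (γ p.2)) (unwindγ hx₀ γ p) (norm_unwindγ hx₀ γ p)
  continuous_toFun := by
    refine Continuous.subtype_mk ((continuous_proj.comp (γ.continuous.comp continuous_snd)).prodMk
      ?_) _
    exact (continuous_unwind _).comp
      ((continuous_subtype_val.comp continuous_fst).prodMk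
        (continuous_subtype_val.comp continuous_snd))
  map_zero_left s := by
    refine ext rfl ?_
    show unwind (isLoopFibre_fibExt hx₀ γ) (((0 : I) : ℝ), (s : ℝ)) = fib (γ s)
    rw [show (((0 : I) : ℝ), (s : ℝ)) = ((0 : ℝ), (s : ℝ)) from rfl, unwind_zero]
    exact fibExt_coe γ s
  map_one_left s := by
    refine ext rfl ?_
    show unwind (isLoopFibre_fibExt hx₀ γ) (((1 : I) : ℝ), (s : ℝ)) = fib (sec hr0 (proj (γ s)))
    rw [fib_sec, show (((1 : I) : ℝ), (s : ℝ)) = ((1 : ℝ), (s : ℝ)) from rfl, unwind_one,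
      fibExt_coe γ s, norm_fib]
  prop' τ s hs := by
    -- at the endpoints `s ∈ {0, 1}` the fibre coordinate vanishes, so nothing moves
    show mk (proj (γ s)) (unwindγ hx₀ γ (τ, s)) _ = γ s
    have hs' : γ s = x₀ := by
      rcases hs with h | h
      · rw [h]; exact γ.source
      · rw [Set.mem_singleton_iff] at h
        rw [h]; exact γ.target
    have hfib : fib (γ s) = 0 := by rw [hs']; exact hx₀
    refine ext rfl ?_
    show unwind (isLoopFibre_fibExt hx₀ γ) ((τ : ℝ), (s : ℝ)) = fib (γ s)
    rw [hfib]
    apply unwind_eq_zero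
    rw [fibExt_coe γ s]
    exact hfib

include hr in
/-- **Every loop at a point with vanishing fibre coordinate is homotopic to its accompanying
loop in the section.** [folklore] -/
theorem homotopic_secPath : γ.Homotopic (secPath hr hr0 hx₀ γ) :=
  ⟨unwindHomotopy hr hr0 hx₀ γ⟩

include hr hr0 in
/-- **The conjugation does not change loops up to homotopy** (at a base point with vanishing
fibre coordinate): `conj ∘ γ ≃ sec ∘ pr₁ ∘ (conj ∘ γ) = sec ∘ pr₁ ∘ γ ≃ γ`. [folklore] -/
theorem homotopic_conjLoop : (conjLoop hx₀ γ).Homotopic γ := by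
  have h₁ := homotopic_secPath hr hr0 hx₀ (conjLoop hx₀ γ)
  rw [secPath_conjLoop hr hr0 hx₀ γ] at h₁
  exact h₁.trans (homotopic_secPath hr hr0 hx₀ γ).symm

include hr hr0 in
/-- **The conjugation of a spun space acts as the identity on the fundamental group** at every
base point with vanishing fibre coordinate (Hatcher (2002), §1.1 for induced maps).  This is
the topological core of the `π₁`-triviality of the mirror symmetry of `♮ᵏ(S¹ × B³)` on
`π₁(#ᵏ S¹ × S²)`. [cite: HatcherAT2002, §1.1] -/
theorem mapOfEq_conjCM_eq (a : _root_.FundamentalGroup (Spun r) x₀) :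
    _root_.FundamentalGroup.mapOfEq (conjCM (r := r)) (conjMap_eq_self_of_fib_eq_zero hx₀) a =
      a := by
  induction a using Quotient.ind with
  | _ γ =>
    rw [_root_.FundamentalGroup.mapOfEq_apply]
    show Path.Homotopic.Quotient.mk (conjLoop hx₀ γ) = Path.Homotopic.Quotient.mk γ
    rw [Path.Homotopic.Quotient.eq]
    exact homotopic_conjLoop hr hr0 hx₀ γ

end Loops

end Spun

end Literature.AlgebraicTopology.FundamentalGroup
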